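import Summits.QuantumFields.BalabanUV.Beta.SecondOrderStepRemainder

/-!
# `BalabanUV.Beta.BorderedHessianStepParity` — binder row D1, the W-side (L4) of the reflection binder hR: THE STEP BORDERED HESSIAN
# `bhKStepAt d ρ Lc j` IS sgn-SYMMETRIC AT EVERY LEVEL (`trK = sgnK`), hence its commutator with ANY diagonal kernel is row-parity-odd and
# tadpole-null against every step propagator — the premise of the owner's parity observation (journal l.10986) kernel-checked
# (β sub-cell, D1 formalisation swarm seat `b2b-balaban-beta-d1-formalise-leaf-05`, gen 5; INTENT «D1-hR-L4-BH-PARITY», journal l.11869)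

HONEST FRAMING (cell contract, verbatim): «discharging `BetaPertH` makes Bałaban's UV stability UNCONDITIONAL — a real
constructive-QFT result; it is NOT the continuum limit and NOT the Clay problem.»  HONEST DEPENDENCY (verbatim): «continuum YM on T⁴ ⇐
BetaPertH ∧ nine spine estimates (0/9 proved); BetaPertH ⇐ (D1) ∧ (D4) ∧ CAP+tail; G-an2-4 gates asym, D1 and NE2/3/4.»  [folklore]
bookkeeping over tree objects BY NAME; no statement of Bałaban's papers, no `[cite:]` tag, no `def`, no `Prop` fact; instantiates NO binder of
the β-function wall; NOT D1, NOT `BetaPertH`, NOT continuum, NOT Clay.  ABSOLUTE RULE (cell, verbatim): «No internally-minted statement may enter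
as a cited fact. Every hypothesis is either kernel-proved in this package or a verbatim quotation of a PUBLISHED theorem with page reference. The
manuscript(s) under audit are NOT citable for their own disputed steps — they are the thing under adjudication; programme-internal
(2001/route/tribunal) claims are never citable.»  Nothing is cited here.

## What is proved (generic `d`; §1 for ANY root `ρ` and blocking)

* §1 `trK_bhKAt`: the rooted bordered Hessian `bhKAt d ρ N` is sgn-symmetric — its field–field block is `bhK`'s (`BorderedHessian.trK_bhK`),
  its border blocks `−[proj = 0]·linAvgAt ρ (delta1 κ x) …` ∕ `+[proj = 0]·linAvgAt ρ (delta1 l y) …` are each other's NEGATIVE transpose (`rfl`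
  on the displayed entries), its mm-block is `0`; `trK_E2`: `E2 d Lc j = mmRead (Lc^j) KInv` is sgn-symmetric (`trK_KInv` + `parityEven_mmRead`);
  **`trK_bhKStepAt`**: `∀ j, trK (bhKStepAt d ρ Lc j) = sgnK (bhKStepAt d ρ Lc j)` (level `0` = `bhKAt`; level `j+1` blockwise: ff `wVH·E2`,
  fm∕mf `stepScale·bhKAt`, mm `0`).
* §2 `parityOdd_conjV_bhKStepAt_diagK`: `conjV (bhKStepAt d ρ Lc j) (diagK Z)` is row-parity-odd for ANY symbol `Z` (the commutator lemma
  `SecondOrderStepRemainder.parityOdd_conjV_diagK_of_even`); `parityOdd_symRem`: the END's remainder shape `½•conjV (bhKStepAt … j) (diagK Z) + ½•(Δ₁ + Δ₂)`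
  is row-parity-odd when `Δ₁`, `Δ₂` are; §3 (wall, in-block root) `tadpole_conjV_bhKStepAt_diagK_eq_zero`: `tadpole G_i (conjV (bhKStepAt … j) (diagK Z)) = 0`
  for every localised diagonal `Z`, all levels `i j` — the PARITY route to what `SecondOrderSymContact.tadpole_conjV_rel_eq_zero` obtains from the
  relative-inverse rules + `[axEc, diagK Z] = 0`; `tadpole_symRem_eq_zero`: the remainder shape has zero tadpole against `G_i` when `Δ₁`, `Δ₂` are
  localised parity-odd — so `V := Rm_j` of the owner's remainder recursion `hR2succ` (`SpineRecursiveT2All` p216525) meets the (PAR) input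
  `trK (V …) = −sgnK (V …)` of (W-REM-PAR) (`SecondOrderStepRemainderWall.…_of_residual`).
Provenance: b2b-balaban β sub-cell, D1 formalisation swarm leaf-05 gen 5, 2026-08-20 (v1); no existing file touched.
-/

noncomputable section

open Finset
open scoped BigOperators
open Literature.MathematicalPhysics.QuantumFieldTheory
open Literature.MathematicalPhysics.QuantumFieldTheory.Balaban1983to89
open Literature.MathematicalPhysics.QuantumFieldTheory.Balaban1983to89.Beta
open ExpKernelCalculus (MKer tadpole)
open AffineAveraging (box toSite)
open OneStepResolventKernel (Fib KInv)
open OneStepKernelFamily (KInvStep)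
open BalabanStepJetsSucc (mmRead E2 wVH)
open Summit.QuantumFields.BalabanUV.Beta.TameKernelCalculus
open Summit.QuantumFields.BalabanUV.Beta.BorderedHessian (sgnF sgnF_inl sgnF_inr sgnK sgnK_apply diagK bhK bhKAt bhKAt_inl_inl bhKAt_inl_inr
  bhKAt_inr_inl bhKAt_inr_inr trK_bhK trK_KInv bhKStepAt bhKStepAt_zero bhKStepAt_succ_inl_inl bhKStepAt_succ_fm bhKStepAt_succ_mf
  bhKStepAt_succ_mm stepScale spr_bhKStepAt)
open Summit.QuantumFields.BalabanUV.Beta.BubbleParity (spr_of_decays trK_coDressKBmAt_KInvStep)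
open Summit.QuantumFields.BalabanUV.Beta.ChartConjugation (conjV loc_conjV)
open Summit.QuantumFields.BalabanUV.Beta.AxialDressingRooted (coDressKBmAt decays_coDressKBmAt_KInvStep)
open Summit.QuantumFields.BalabanUV.Beta.KernelWardRelativeEnd (tadpole_eq_zero_of_parity)
open Summit.QuantumFields.BalabanUV.Beta.KernelWardRemainderParity (parityOdd_add)
open Summit.QuantumFields.BalabanUV.Beta.SpineRecursiveParity (parityOdd_smul)
open Summit.QuantumFields.BalabanUV.Beta.SecondOrderStepRemainder (parityOdd_conjV_diagK_of_even parityEven_mmRead)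

namespace Summit.QuantumFields.BalabanUV.Beta.BorderedHessianStepParity

variable {d : ℕ}

/-! ## §1 sgn-symmetry of the rooted and of the step bordered Hessian -/

section Sgn

/-- [folklore] **THE ROOTED BORDERED HESSIAN IS sgn-SYMMETRIC**: `trK (bhKAt d ρ N) = sgnK (bhKAt d ρ N)`, for ANY root `ρ` — ff block
symmetric (`trK_bhK`), border blocks negative-transposed (`rfl` on the entries), mm block `0`. -/
theorem trK_bhKAt (ρ : Fin (d + 1) → ℤ) (N : ℕ) [NeZero N] : trK (bhKAt d ρ N) = sgnK (bhKAt d ρ N) := by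
  funext x y a b
  rw [trK_apply, sgnK_apply]
  rcases a with κ | κ <;> rcases b with l | l
  · have e := congrFun (congrFun (congrFun (congrFun (trK_bhK (d := d) N) x) y) (Sum.inl κ)) (Sum.inl l)
    rw [trK_apply, sgnK_apply] at e
    rw [bhKAt_inl_inl, bhKAt_inl_inl]
    exact e
  · rw [bhKAt_inr_inl, bhKAt_inl_inr, sgnF_inl, sgnF_inr]
    split_ifs <;> ring
  · rw [bhKAt_inl_inr, bhKAt_inr_inl, sgnF_inr, sgnF_inl]
    split_ifs <;> ring
  · rw [bhKAt_inr_inr, bhKAt_inr_inr]; ring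

/-- [folklore] **THE STEP VALUE HESSIAN `E2 d Lc j = mmRead (Lc^j) KInv` IS sgn-SYMMETRIC** (`trK_KInv` read through `parityEven_mmRead`). -/
theorem trK_E2 (Lc : ℕ) [NeZero Lc] (j : ℕ) : trK (E2 d Lc j) = sgnK (E2 d Lc j) :=
  parityEven_mmRead (Lc ^ j) (trK_KInv (Lc ^ j))

/-- [folklore] **THE STEP BORDERED HESSIAN IS sgn-SYMMETRIC AT EVERY LEVEL**: `trK (bhKStepAt d ρ Lc j) = sgnK (bhKStepAt d ρ Lc j)` — the
premise «parity-even `𝕄_j`» of the row owner's parity observation (journal l.10986), for ANY root `ρ`. -/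
theorem trK_bhKStepAt (ρ : Fin (d + 1) → ℤ) (Lc : ℕ) [NeZero Lc] : ∀ j : ℕ, trK (bhKStepAt d ρ Lc j) = sgnK (bhKStepAt d ρ Lc j)
  | 0 => by rw [bhKStepAt_zero]; exact trK_bhKAt ρ Lc
  | j + 1 => by
    have hA := trK_bhKAt (d := d) ρ Lc
    have hE := trK_E2 (d := d) Lc (j + 1)
    funext x y a b
    rw [trK_apply, sgnK_apply]
    rcases a with κ | κ <;> rcases b with l | l
    · have e := congrFun (congrFun (congrFun (congrFun hE x) y) (Sum.inl κ)) (Sum.inl l)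
      simp only [trK_apply, sgnK_apply, sgnF_inl, one_mul] at e
      simp only [bhKStepAt_succ_inl_inl, sgnF_inl, one_mul, e]
    · have e := congrFun (congrFun (congrFun (congrFun hA x) y) (Sum.inl κ)) (Sum.inr l)
      rw [trK_apply, sgnK_apply] at e
      rw [bhKStepAt_succ_mf, bhKStepAt_succ_fm, e]
      ring
    · have e := congrFun (congrFun (congrFun (congrFun hA x) y) (Sum.inr κ)) (Sum.inl l)
      rw [trK_apply, sgnK_apply] at e
      rw [bhKStepAt_succ_fm, bhKStepAt_succ_mf, e]
      ring
    · rw [bhKStepAt_succ_mm, bhKStepAt_succ_mm]; ring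

end Sgn

/-! ## §2 Parity of the commutator contact and of the symmetrised remainder shape -/

section Parity

variable (ρ : Fin (d + 1) → ℤ) (Lc : ℕ) [NeZero Lc]

/-- [folklore] **THE COMMUTATOR OF THE STEP BORDERED HESSIAN WITH ANY DIAGONAL KERNEL IS ROW-PARITY-ODD** (every level, any root, any symbol). -/
theorem parityOdd_conjV_bhKStepAt_diagK (j : ℕ) (Z : (Fin (d + 1) → ℤ) → Fib d → ℝ) :
    trK (conjV (bhKStepAt d ρ Lc j) (diagK Z)) = -sgnK (conjV (bhKStepAt d ρ Lc j) (diagK Z)) :=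
  parityOdd_conjV_diagK_of_even Z (trK_bhKStepAt ρ Lc j)

/-- [folklore] **THE END's SYMMETRISED REMAINDER SHAPE IS ROW-PARITY-ODD**: `½•conjV (bhKStepAt … j) (diagK Z) + ½•(Δ₁ + Δ₂)` is parity-odd
whenever `Δ₁`, `Δ₂` are — the `Rm` of `SpineRecursiveRemainder.…_closed_bcj_rem` ∕ the `V` of the remainder recursion `hR2succ`. -/
theorem parityOdd_symRem (j : ℕ) (Z : (Fin (d + 1) → ℤ) → Fib d → ℝ) {Δ₁ Δ₂ : MKer (d + 1) (Fib d)} (h₁ : trK Δ₁ = -sgnK Δ₁)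
    (h₂ : trK Δ₂ = -sgnK Δ₂) :
    trK ((1 / 2 : ℝ) • conjV (bhKStepAt d ρ Lc j) (diagK Z) + (1 / 2 : ℝ) • (Δ₁ + Δ₂)) =
      -sgnK ((1 / 2 : ℝ) • conjV (bhKStepAt d ρ Lc j) (diagK Z) + (1 / 2 : ℝ) • (Δ₁ + Δ₂)) :=
  parityOdd_add (parityOdd_smul _ (parityOdd_conjV_bhKStepAt_diagK ρ Lc j Z)) (parityOdd_smul _ (parityOdd_add h₁ h₂))

end Parity

/-! ## §3 The wall: zero tadpole against every step propagator (in-block root) -/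

section Wall

variable {Lc : ℕ} [NeZero Lc]

/-- [folklore] **THE COMMUTATOR CONTACT HAS ZERO TADPOLE AGAINST EVERY STEP PROPAGATOR, BY PARITY**: for any localised diagonal `diagK Z`,
`tadpole G_i (conjV (bhKStepAt d (toSite r) Lc j) (diagK Z)) = 0`, all levels `i`, `j` — no relative-inverse rule and no commutation with the
coarse projector needed (contrast `SecondOrderSymContact.tadpole_conjV_rel_eq_zero`). -/
theorem tadpole_conjV_bhKStepAt_diagK_eq_zero {r : Fin (d + 1) → ℕ} (hr : r ∈ box (d + 1) Lc) (i j : ℕ)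
    {Z : (Fin (d + 1) → ℤ) → Fib d → ℝ} (hZ : Loc (diagK Z)) :
    tadpole (coDressKBmAt (toSite r) Lc (KInvStep (d := d) Lc i)) (conjV (bhKStepAt d (toSite r) Lc j) (diagK Z)) = 0 :=
  tadpole_eq_zero_of_parity (spr_of_decays (decays_coDressKBmAt_KInvStep hr i)) (trK_coDressKBmAt_KInvStep hr i)
    (loc_conjV (spr_bhKStepAt hr j) hZ) (parityOdd_conjV_bhKStepAt_diagK (toSite r) Lc j Z)

/-- [folklore] **THE SYMMETRISED REMAINDER SHAPE HAS ZERO TADPOLE AGAINST EVERY STEP PROPAGATOR** when `Δ₁`, `Δ₂` are localised and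
row-parity-odd and `diagK Z` is localised — the `hRm0` socket for `Rm := ½•conjV 𝕄_j (diagK Z) + ½•(Δ₁ + Δ₂)` by parity alone. -/
theorem tadpole_symRem_eq_zero {r : Fin (d + 1) → ℕ} (hr : r ∈ box (d + 1) Lc) (i j : ℕ) {Z : (Fin (d + 1) → ℤ) → Fib d → ℝ}
    (hZ : Loc (diagK Z)) {Δ₁ Δ₂ : MKer (d + 1) (Fib d)} (hl₁ : Loc Δ₁) (hl₂ : Loc Δ₂) (h₁ : trK Δ₁ = -sgnK Δ₁) (h₂ : trK Δ₂ = -sgnK Δ₂) :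
    tadpole (coDressKBmAt (toSite r) Lc (KInvStep (d := d) Lc i))
      ((1 / 2 : ℝ) • conjV (bhKStepAt d (toSite r) Lc j) (diagK Z) + (1 / 2 : ℝ) • (Δ₁ + Δ₂)) = 0 :=
  tadpole_eq_zero_of_parity (spr_of_decays (decays_coDressKBmAt_KInvStep hr i)) (trK_coDressKBmAt_KInvStep hr i)
    (((loc_conjV (spr_bhKStepAt hr j) hZ).smul _).add ((hl₁.add hl₂).smul _)) (parityOdd_symRem (toSite r) Lc j Z h₁ h₂)

end Wall

end Summit.QuantumFields.BalabanUV.Beta.BorderedHessianStepParity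

end
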